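import Summits.QuantumFields.QCD.Theses.SpectralDefectExtinction
import Summits.QuantumFields.QCD.Theorems.SpectralDefectExtinctionExtinctionBuildsQCDStubWellBudget
import Summits.QuantumFields.QCD.Theorems.ExtinctionBuildsQCD.Negative.ExtinctIntegrable
import Summits.QuantumFields.QCD.Theorems.ExtinctionBuildsQCD.Negative.WeylWindow
import Literature.Barriers.QuantumFields.WilsonDeterminantSign
import Literature.MathematicalPhysics.QuantumFieldTheory.QCDPhaseQuenchedPositivity
import Literature.MathematicalPhysics.QuantumFieldTheory.QCDPhaseQuenchedTranslation
import Literature.MathematicalPhysics.QuantumLattice.WilsonDiracRangeOne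
import Literature.MathematicalPhysics.QuantumLattice.OverlapKernelTools

/-!
# Stub R2 `stub_localRarityOfExtinct` of line `determinant-tilt` (crux `SpectralDefectExtinction.ExtinctionBuildsQCD`,
# item stmt-QuantumFields-18064): LOCAL RARITY OF BAD BALLS FROM EXTINCT

EXTINCT (phase-quenched reading) bounds the MEAN of the GLOBAL window count `#{λ ∈ spec Γ₅D_W(U, m_f(k), 1) : |λ| < w_f(k)}`,
`w_f(k) = c a_k m_f/Z_k`, by `ε ((2S+1)/(2L_k+1))⁴` on every torus `2S+1 ≥ 2L_k+1`.  This file makes it LOCAL (the input of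
K_FM): the phase-quenched probability that the taxi ball `B(x₀, r)` is BAD at level `0 < τ ≤ w_f(k)` (carries `φ ≠ 0`,
`supp φ ⊆ B(x₀, r)`, `‖Γ₅D_W φ‖² < τ²‖φ‖²`) is `≤ ε (4r+5)⁴/(2L_k+1)⁴`.  COUNTING (§2, pointwise in `U`): a maximal
`(2r+3)`-separated family of bad centres carries disjointly supported quasi-modes with disjointly supported, hence
orthogonal, images (`D_W` has range one), so its size is at most the window count (well budget
`BlockAwayTheSign.stub_wellBudget`), and every bad centre is within `2r+2` of it: `#{bad centres} ≤ (4r+5)⁴ #{|λ| < τ}`.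
AVERAGING (§3–§5): the bad event is translation covariant (`wilsonDirac_torusConfigShift`) and open (hence measurable),
`⟨·⟩₊` is translation invariant (`wilsonMeasure_map_torusConfigShift`, `det_diracMatrix_torusConfigShift`), and the
EXTINCT integrand is measurable and bounded (`Negative.ExtinctIntegrable`), so `(2S+1)⁴ ⟨1_bad(x₀)⟩₊ = ⟨#{bad centres}⟩₊
≤ (4r+5)⁴ ⟨window count⟩₊`.  References (prose): Aizenman–Schenker–Friedrich–Hundertmark, CMP 224 (2001) §2 (translation
averaging of a finite-volume criterion); Montvay–Münster 1994 §5.1.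
-/
noncomputable section

namespace Summit.QuantumFields.QCD.Cruxes.ExtinctionBuildsQCD.DeterminantTilt

open scoped BigOperators Topology Classical MeasureTheory Matrix ENNReal
open Filter MeasureTheory Matrix
open Literature.MathematicalPhysics.QuantumLattice Literature.MathematicalPhysics.QuantumFieldTheory
  Literature.Probability.LatticeModels Literature.MathematicalPhysics.AQFT
open Summit.QuantumFields.QCD.Theses.SpectralDefectExtinction
open Literature.Barriers.QuantumFields.WilsonDeterminant (hermitianWilsonDirac Idx isHermitian_hermitianWilsonDirac)
open Summit.QuantumFields.QCD.Theorems.ExtinctionBuildsQCD.Negative (measurable_signDefectCount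
  measurable_coercivityDefectCount countP_roots_charpoly_le_card countP_le_countP_of_imp)

/-! ## §1 Taxi geometry on the four-torus -/

section Geometry

variable {L : ℕ} [NeZero L]

omit [NeZero L] in
/-- The periodic taxi distance is translation invariant: `d(y + v, x) = d(y, x − v)`. -/
theorem locRar_torusTaxiDist_add_left (y v x : TorusSite 4 L) :
    torusTaxiDist (y + v) x = torusTaxiDist y (x - v) := by
  unfold torusTaxiDist
  refine Finset.sum_congr rfl fun i _ => ?_
  rw [Pi.add_apply, Pi.sub_apply, show y i + v i - x i = y i - (x i - v i) by ring]

/-- Taxi balls are small uniformly in the torus size: `#{x : d(x, x₀) ≤ R} ≤ (2R+1)⁴` (the ball is covered by the cube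
`x₀ + box 4 R` via minimal representatives).  Private copy of `…StubConditionalSmallBallAux.card_taxiBall_le`, whose module is
accepted but not yet built on the Lean farm (not importable at the time of writing). -/
private theorem card_taxiBall_leR2 (x₀ : TorusSite 4 L) (R : ℕ) :
    (Finset.univ.filter (fun x : TorusSite 4 L => torusTaxiDist x x₀ ≤ R)).card ≤ (2 * R + 1) ^ 4 := by
  -- adapted from Theorems/SpectralDefectExtinctionExtinctionBuildsQCDStubConditionalSmallBallAux.lean:card_taxiBall_le
  have hsub : Finset.univ.filter (fun x : TorusSite 4 L => torusTaxiDist x x₀ ≤ R) ⊆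
      (box 4 R).image (fun y => x₀ + Torus.proj L y) := by
    intro x hx
    have hxr : torusTaxiDist x x₀ ≤ R := (Finset.mem_filter.1 hx).2
    refine Finset.mem_image.2 ⟨fun i => (x i - x₀ i).valMinAbs, ?_, funext fun i => by simp [ZMod.coe_valMinAbs]⟩
    rw [mem_box]
    intro i
    have h1 : ((x i - x₀ i).valMinAbs).natAbs ≤ R := by
      rw [ZMod.valMinAbs_natAbs_eq_min]
      exact le_trans (Finset.single_le_sum (f := fun j => min (x j - x₀ j).val (L - (x j - x₀ j).val))
        (fun _ _ => Nat.zero_le _) (Finset.mem_univ i)) hxr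
    omega
  exact (Finset.card_le_card hsub).trans (Finset.card_image_le.trans (card_box 4 R).le)

/-- **Range one of `H = Γ₅ D_W`.** If `φ` vanishes outside the taxi ball `B(x, R)` then `H φ` vanishes outside
`B(x, R+1)`: `D_W p q ≠ 0` forces `d(p, q) ≤ 1` (`torusTaxiDist_le_one_of_wilsonDirac_ne_zero`) and `Γ₅` is diagonal. -/
theorem locRar_hermitianWilsonDirac_mulVec_eq_zero (U : GaugeConfig 4 L SU3) (m₀ : ℝ) (x : TorusSite 4 L) (R : ℕ)
    (φ : Idx L 3 → ℂ) (hφ : ∀ p, R < torusTaxiDist p.1 x → φ p = 0) (p : Idx L 3)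
    (hp : R + 1 < torusTaxiDist p.1 x) :
    (hermitianWilsonDirac (fundamentalRep (Fin 3)) U m₀ 1 *ᵥ φ) p = 0 := by
  have hD : (wilsonDirac (fundamentalRep (Fin 3)) U m₀ 1 *ᵥ φ) p = 0 := by
    simp only [Matrix.mulVec, dotProduct]
    refine Finset.sum_eq_zero fun q _ => ?_
    by_cases hq : R < torusTaxiDist q.1 x
    · rw [hφ q hq, mul_zero]
    · have hDpq : wilsonDirac (fundamentalRep (Fin 3)) U m₀ 1 p q = 0 := by
        by_contra h
        have h1 := torusTaxiDist_le_one_of_wilsonDirac_ne_zero (fundamentalRep (Fin 3))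
          fundamentalRep_mem_unitaryGroup U m₀ p q h
        have h2 := torusTaxiDist_triangle p.1 q.1 x
        omega
      rw [hDpq, zero_mul]
  simp only [hermitianWilsonDirac, ← Matrix.mulVec_mulVec, spinorLift_gammaFive_eq_diagonal, mulVec_diagonal, hD,
    mul_zero]

/-! ## §2 Counting: bad centres versus the window count (pointwise in the gauge field) -/

/-- **Pointwise counting.** For every `SU(3)` field `U`, mass `m₀`, level `τ > 0` and radius `r`: the number of centres
`x` whose taxi ball `B(x, r)` carries a quasi-mode of `H = Γ₅D_W(U, m₀, 1)` strictly below level `τ` is at most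
`(4r+5)⁴ · #{roots z of charpoly H with |Re z| < τ}`.  A maximal `(2r+3)`-separated family `M` of bad centres carries
disjointly supported quasi-modes with disjointly supported images (range one), so `|M| ≤ #{|Re z| < τ}` by the well
budget; every bad centre is within `2r+2` of `M` (maximality), and `#B(·, 2r+2) ≤ (4r+5)⁴`. -/
theorem locRar_card_bad_le (U : GaugeConfig 4 L SU3) (m₀ τ : ℝ) (hτ : 0 < τ) (r : ℕ) :
    (Finset.univ.filter fun x : TorusSite 4 L => ∃ φ : Idx L 3 → ℂ, φ ≠ 0 ∧ (∀ p, r < torusTaxiDist p.1 x → φ p = 0) ∧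
        ∑ p, ‖(hermitianWilsonDirac (fundamentalRep (Fin 3)) U m₀ 1 *ᵥ φ) p‖ ^ 2 < τ ^ 2 * ∑ p, ‖φ p‖ ^ 2).card ≤
      (4 * r + 5) ^ 4 * (hermitianWilsonDirac (fundamentalRep (Fin 3)) U m₀ 1).charpoly.roots.countP
        (fun z => |z.re| < τ) := by
  set H : Matrix (Idx L 3) (Idx L 3) ℂ := hermitianWilsonDirac (fundamentalRep (Fin 3)) U m₀ 1 with hH
  set Bad : Finset (TorusSite 4 L) := Finset.univ.filter fun x : TorusSite 4 L => ∃ φ : Idx L 3 → ℂ, φ ≠ 0 ∧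
      (∀ p, r < torusTaxiDist p.1 x → φ p = 0) ∧ ∑ p, ‖(H *ᵥ φ) p‖ ^ 2 < τ ^ 2 * ∑ p, ‖φ p‖ ^ 2 with hBad
  -- the separated subfamilies of `Bad` and one of maximal size
  set fam : Finset (Finset (TorusSite 4 L)) := Bad.powerset.filter fun M =>
      (M : Set (TorusSite 4 L)).Pairwise fun x y => 2 * r + 2 < torusTaxiDist x y with hfam
  have hne : fam.Nonempty := ⟨∅, by simp [hfam]⟩
  obtain ⟨M, hM, hmax⟩ := Finset.exists_max_image fam Finset.card hne
  have hMB : M ⊆ Bad := Finset.mem_powerset.1 (Finset.mem_filter.1 hM).1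
  have hMsep : (M : Set (TorusSite 4 L)).Pairwise fun x y => 2 * r + 2 < torusTaxiDist x y :=
    (Finset.mem_filter.1 hM).2
  -- (a) maximality: every bad centre is within `2r+2` of `M`
  have hcover : ∀ y ∈ Bad, ∃ x ∈ M, torusTaxiDist y x ≤ 2 * r + 2 := by
    intro y hy
    by_contra hcon
    push Not at hcon
    have hyM : y ∉ M := fun h => by have := hcon y h; rw [torusTaxiDist_self] at this; omega
    have hins : insert y M ∈ fam := by
      refine Finset.mem_filter.2 ⟨Finset.mem_powerset.2 (Finset.insert_subset hy hMB), ?_⟩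
      rw [Finset.coe_insert]
      exact hMsep.insert fun b hb _ => ⟨hcon b hb, by rw [torusTaxiDist_comm]; exact hcon b hb⟩
    have := hmax _ hins
    rw [Finset.card_insert_of_notMem hyM] at this
    omega
  -- (b) `#Bad ≤ |M| (4r+5)⁴`
  have hcardBad : Bad.card ≤ M.card * (4 * r + 5) ^ 4 := by
    have hsub : Bad ⊆ M.biUnion fun x => Finset.univ.filter fun y : TorusSite 4 L => torusTaxiDist y x ≤ 2 * r + 2 := by
      intro y hy
      obtain ⟨x, hx, hxy⟩ := hcover y hy
      exact Finset.mem_biUnion.2 ⟨x, hx, Finset.mem_filter.2 ⟨Finset.mem_univ _, hxy⟩⟩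
    calc Bad.card ≤ (M.biUnion fun x => Finset.univ.filter fun y : TorusSite 4 L => torusTaxiDist y x ≤ 2 * r + 2).card :=
          Finset.card_le_card hsub
      _ ≤ ∑ x ∈ M, (Finset.univ.filter fun y : TorusSite 4 L => torusTaxiDist y x ≤ 2 * r + 2).card :=
          Finset.card_biUnion_le
      _ ≤ ∑ x ∈ M, (4 * r + 5) ^ 4 := Finset.sum_le_sum fun x _ =>
          (card_taxiBall_leR2 x (2 * r + 2)).trans (by ring_nf; exact le_rfl)
      _ = M.card * (4 * r + 5) ^ 4 := by rw [Finset.sum_const, smul_eq_mul]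
  -- (c) `|M| ≤` window count, by the well budget on the chosen quasi-modes
  have hMle : M.card ≤ H.charpoly.roots.countP (fun z => |z.re| < τ) := by
    set e : Fin M.card ≃ {x // x ∈ M} := M.equivFin.symm with he
    have hbadM : ∀ a : Fin M.card, ∃ φ : Idx L 3 → ℂ, φ ≠ 0 ∧ (∀ p, r < torusTaxiDist p.1 (e a).1 → φ p = 0) ∧
        ∑ p, ‖(H *ᵥ φ) p‖ ^ 2 < τ ^ 2 * ∑ p, ‖φ p‖ ^ 2 := fun a => (Finset.mem_filter.1 (hMB (e a).2)).2
    choose φ hφ0 hφsupp hφlt using hbadM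
    have hHerm : H.IsHermitian := isHermitian_hermitianWilsonDirac _ fundamentalRep_mem_unitaryGroup U m₀ 1
    have hsep : ∀ a b : Fin M.card, a ≠ b → 2 * r + 2 < torusTaxiDist (e a).1 (e b).1 := fun a b hab =>
      hMsep (e a).2 (e b).2 fun h => hab (e.injective (Subtype.ext h))
    refine BlockAwayTheSign.stub_wellBudget hHerm τ hτ φ (fun a b hab i => ?_) (fun a b hab => ?_) hφlt
    · by_cases hi : r < torusTaxiDist i.1 (e a).1
      · exact Or.inl (hφsupp a i hi)
      · refine Or.inr (hφsupp b i ?_)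
        have h1 := hsep a b hab
        have h2 := torusTaxiDist_triangle (e a).1 i.1 (e b).1
        rw [torusTaxiDist_comm (e a).1 i.1] at h2
        omega
    · rw [dotProduct]
      refine Finset.sum_eq_zero fun i _ => ?_
      by_cases hi : r + 1 < torusTaxiDist i.1 (e a).1
      · rw [Pi.star_apply, hH, locRar_hermitianWilsonDirac_mulVec_eq_zero U m₀ _ r (φ a) (hφsupp a) i hi, star_zero,
          zero_mul]
      · have h1 := hsep a b hab
        have h2 := torusTaxiDist_triangle (e a).1 i.1 (e b).1
        rw [torusTaxiDist_comm (e a).1 i.1] at h2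
        rw [hH, locRar_hermitianWilsonDirac_mulVec_eq_zero U m₀ _ r (φ b) (hφsupp b) i (by omega), mul_zero]
  calc Bad.card ≤ M.card * (4 * r + 5) ^ 4 := hcardBad
    _ ≤ H.charpoly.roots.countP (fun z => |z.re| < τ) * (4 * r + 5) ^ 4 := Nat.mul_le_mul_right _ hMle
    _ = _ := mul_comm _ _

/-! ## §3 The bad event: measurability and translation covariance -/

/-- **The bad event is open, hence measurable, in the gauge field**: it is the union over `φ` of the strict sublevel
sets `{U | ‖H_U φ‖² < τ²‖φ‖²}` of continuous functions of `U` (`continuous_wilsonDirac`). -/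
theorem locRar_measurableSet_bad (m₀ τ : ℝ) (x : TorusSite 4 L) (r : ℕ) :
    MeasurableSet {U : GaugeConfig 4 L SU3 | ∃ φ : Idx L 3 → ℂ, φ ≠ 0 ∧ (∀ p, r < torusTaxiDist p.1 x → φ p = 0) ∧
      ∑ p, ‖(hermitianWilsonDirac (fundamentalRep (Fin 3)) U m₀ 1 *ᵥ φ) p‖ ^ 2 < τ ^ 2 * ∑ p, ‖φ p‖ ^ 2} := by
  refine IsOpen.measurableSet ?_
  simp only [Set.setOf_exists, Set.setOf_and]
  refine isOpen_iUnion fun φ => isOpen_const.inter (isOpen_const.inter ?_)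
  have hH : Continuous fun U : GaugeConfig 4 L SU3 => hermitianWilsonDirac (fundamentalRep (Fin 3)) U m₀ 1 :=
    continuous_const.matrix_mul (continuous_wilsonDirac _ (continuous_fundamentalRep (Fin 3)) m₀ 1)
  exact isOpen_lt (continuous_finsetSum _ fun p _ =>
    ((continuous_apply p).comp (hH.matrix_mulVec continuous_const)).norm.pow 2) continuous_const

/-- **Translation covariance of `H = Γ₅ D_W`**: `H[τ_v U]` is `H[U]` reindexed by `(y, a, α) ↦ (y − v, a, α)`
(`wilsonDirac_torusConfigShift`; `Γ₅` is a site-independent diagonal). -/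
theorem locRar_hermitianWilsonDirac_torusConfigShift (v : TorusSite 4 L) (U : GaugeConfig 4 L SU3) (m₀ r₀ : ℝ) :
    hermitianWilsonDirac (fundamentalRep (Fin 3)) (torusConfigShift v U) m₀ r₀ =
      (hermitianWilsonDirac (fundamentalRep (Fin 3)) U m₀ r₀).submatrix (fun p => (p.1 - v, p.2))
        (fun p => (p.1 - v, p.2)) := by
  ext p q
  simp only [hermitianWilsonDirac, wilsonDirac_torusConfigShift, spinorLift_gammaFive_eq_diagonal, diagonal_mul,
    submatrix_apply]

/-- **Translation covariance of the bad event**: if `B(x, r)` is bad for the translated field `τ_v U` then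
`B(x − v, r)` is bad for `U` (transport the quasi-mode along `(y, a, α) ↦ (y + v, a, α)`). -/
theorem locRar_bad_of_bad_torusConfigShift (v : TorusSite 4 L) (U : GaugeConfig 4 L SU3) (m₀ τ : ℝ)
    (x : TorusSite 4 L) (r : ℕ)
    (h : ∃ φ : Idx L 3 → ℂ, φ ≠ 0 ∧ (∀ p, r < torusTaxiDist p.1 x → φ p = 0) ∧
      ∑ p, ‖(hermitianWilsonDirac (fundamentalRep (Fin 3)) (torusConfigShift v U) m₀ 1 *ᵥ φ) p‖ ^ 2 <
        τ ^ 2 * ∑ p, ‖φ p‖ ^ 2) :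
    ∃ φ : Idx L 3 → ℂ, φ ≠ 0 ∧ (∀ p, r < torusTaxiDist p.1 (x - v) → φ p = 0) ∧
      ∑ p, ‖(hermitianWilsonDirac (fundamentalRep (Fin 3)) U m₀ 1 *ᵥ φ) p‖ ^ 2 < τ ^ 2 * ∑ p, ‖φ p‖ ^ 2 := by
  obtain ⟨φ, hφ0, hsupp, hlt⟩ := h
  set σ : Idx L 3 ≃ Idx L 3 := (Equiv.subRight v).prodCongr (Equiv.refl (Fin 3 × Fin 4)) with hσ
  have hσe : (fun p : Idx L 3 => (p.1 - v, p.2)) = ⇑σ := rfl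
  have hσs : ∀ q : Idx L 3, σ.symm q = (q.1 + v, q.2) := fun q => by
    rw [Equiv.symm_apply_eq]; ext <;> simp [hσ]
  refine ⟨φ ∘ σ.symm, fun h0 => hφ0 (funext fun p => by simpa using congrFun h0 (σ p)), fun q hq => ?_, ?_⟩
  · rw [Function.comp_apply, hσs]
    exact hsupp _ (by rwa [locRar_torusTaxiDist_add_left])
  · have hmul : hermitianWilsonDirac (fundamentalRep (Fin 3)) (torusConfigShift v U) m₀ 1 *ᵥ φ =
        (hermitianWilsonDirac (fundamentalRep (Fin 3)) U m₀ 1 *ᵥ (φ ∘ σ.symm)) ∘ σ := by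
      rw [locRar_hermitianWilsonDirac_torusConfigShift, hσe, submatrix_mulVec_equiv]
    have h1 : ∑ p, ‖(hermitianWilsonDirac (fundamentalRep (Fin 3)) (torusConfigShift v U) m₀ 1 *ᵥ φ) p‖ ^ 2 =
        ∑ p, ‖(hermitianWilsonDirac (fundamentalRep (Fin 3)) U m₀ 1 *ᵥ (φ ∘ σ.symm)) p‖ ^ 2 := by
      rw [hmul]
      exact Equiv.sum_comp σ (fun q => ‖(hermitianWilsonDirac (fundamentalRep (Fin 3)) U m₀ 1 *ᵥ (φ ∘ σ.symm)) q‖ ^ 2)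
    have h2 : ∑ p, ‖φ p‖ ^ 2 = ∑ p, ‖(φ ∘ σ.symm) p‖ ^ 2 := (Equiv.sum_comp σ.symm (fun q => ‖φ q‖ ^ 2)).symm
    rw [h1, h2] at hlt
    exact hlt

/-- **The bad events at two centres are translates of each other**: `B(x, r)` is bad for `U` iff `B(x₀, r)` is bad for
`τ_{x₀ − x} U`. -/
theorem locRar_bad_iff_bad_torusConfigShift (U : GaugeConfig 4 L SU3) (m₀ τ : ℝ) (x₀ x : TorusSite 4 L) (r : ℕ) :
    (∃ φ : Idx L 3 → ℂ, φ ≠ 0 ∧ (∀ p, r < torusTaxiDist p.1 x → φ p = 0) ∧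
      ∑ p, ‖(hermitianWilsonDirac (fundamentalRep (Fin 3)) U m₀ 1 *ᵥ φ) p‖ ^ 2 < τ ^ 2 * ∑ p, ‖φ p‖ ^ 2) ↔
    (∃ φ : Idx L 3 → ℂ, φ ≠ 0 ∧ (∀ p, r < torusTaxiDist p.1 x₀ → φ p = 0) ∧
      ∑ p, ‖(hermitianWilsonDirac (fundamentalRep (Fin 3)) (torusConfigShift (x₀ - x) U) m₀ 1 *ᵥ φ) p‖ ^ 2 <
        τ ^ 2 * ∑ p, ‖φ p‖ ^ 2) := by
  constructor
  · intro h
    have hU : torusConfigShift (-(x₀ - x)) (torusConfigShift (x₀ - x) U) = U := funext fun e => by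
      simp only [torusConfigShift_apply, sub_sub, neg_add_cancel, sub_zero, Prod.mk.eta]
    have h' := locRar_bad_of_bad_torusConfigShift (-(x₀ - x)) (torusConfigShift (x₀ - x) U) m₀ τ x r (by rwa [hU])
    rwa [sub_neg_eq_add, add_sub_cancel] at h'
  · intro h
    have h' := locRar_bad_of_bad_torusConfigShift (x₀ - x) U m₀ τ x₀ r h
    rwa [sub_sub_cancel] at h'

/-! ## §4 Translation invariance of the phase-quenched expectation -/

/-- **`⟨F ∘ τ_v⟩₊ = ⟨F⟩₊`** for every observable `F` and lattice vector `v`: the weight `|det D|` is translation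
invariant (`det_diracMatrix_torusConfigShift`) and `τ_v` is a measurable equivalence preserving the Wilson measure
(`wilsonMeasure_map_torusConfigShift`); no measurability of `F` is needed. -/
theorem locRar_qcdPhaseQuenchedExpect_comp_torusConfigShift {Nf : ℕ} {E : Type*} [NormedAddCommGroup E]
    [NormedSpace ℝ E] (β : ℝ) (mq : Fin Nf → ℝ) (v : TorusSite 4 L) (F : GaugeConfig 4 L SU3 → E) :
    qcdPhaseQuenchedExpect β L mq (fun U => F (torusConfigShift v U)) = qcdPhaseQuenchedExpect β L mq F := by
  rw [qcdPhaseQuenchedExpect_def, qcdPhaseQuenchedExpect_def]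
  congr 1
  have h : ∀ U : GaugeConfig 4 L SU3, ‖(diracMatrix U mq).det‖ • F (torusConfigShift v U) =
      (fun V : GaugeConfig 4 L SU3 => ‖(diracMatrix V mq).det‖ • F V) (torusConfigShift v U) := fun U => by
    simp only [det_diracMatrix_torusConfigShift]
  simp_rw [h]
  rw [← integral_map_equiv (torusConfigShift (G := SU3) v) (fun V => ‖(diracMatrix V mq).det‖ • F V),
    wilsonMeasure_map_torusConfigShift]

end Geometry

/-! ## §5 The registered stub -/

/-- **Stub R2 (`stub_localRarityOfExtinct`) — LOCAL RARITY OF BAD BALLS FROM EXTINCT.** For regularisation data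
`(reg, c, m)`, `c > 0`, `m > 0`, with the EXTINCT clause read phase-quenched: for every `ε > 0`, eventually in `k`, on every
torus `2S+1 ≥ 2L_k+1`, for every flavour `f`, centre `x₀`, radius `r` and level `0 < τ ≤ w_f(k) = c a_k m_f/Z_k`, the
phase-quenched probability that `B(x₀, r)` carries a quasi-mode `φ ≠ 0`, `supp φ ⊆ B(x₀, r)`, `‖Γ₅D_W(m_f(k)) φ‖² < τ²‖φ‖²`
is `≤ ε (4r+5)⁴/(2L_k+1)⁴`: pointwise `#{bad centres} ≤ (4r+5)⁴ #{|λ| < τ} ≤ (4r+5)⁴ · (EXTINCT count)` (`locRar_card_bad_le`,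
`τ ≤ w_f(k)`, the other counts are `≥ 0`), and by translation invariance `(2S+1)⁴ ⟨1_bad(x₀)⟩₊ = ⟨#{bad centres}⟩₊` (honest
integrals against the probability measure `qcdLatticeMeasure`).  Unconditional: no Wegner input. -/
theorem stub_localRarityOfExtinct :
    ∀ (Nf : ℕ) (reg : QCDRegularisation Nf) (c : ℝ) (m : Fin Nf → ℝ), 0 < c → (∀ f, 0 < m f) →
      (∀ ε : ℝ, 0 < ε → ∀ᶠ k in atTop, ∀ S : ℕ, reg.L k ≤ S → qcdPhaseQuenchedExpect (reg.β k) (2 * S + 1) (fun f => reg.mcrit k + reg.a k * m f / reg.Zm k) (fun U => ∑ f : Fin Nf, ((Multiset.countP (fun z : ℂ => z.im = 0 ∧ z.re < -(reg.mcrit k + reg.a k * m f / reg.Zm k)) (wilsonDirac (fundamentalRep (Fin 3)) U 0 1).charpoly.roots : ℝ) + (Multiset.countP (fun z : ℂ => |z.re| < c * (reg.a k * m f / reg.Zm k)) (spinorLift gammaFive * wilsonDirac (fundamentalRep (Fin 3)) U (reg.mcrit k + reg.a k * m f / reg.Zm k) 1).charpoly.roots : ℝ))) ≤ ε * ((2 *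 S + 1 : ℝ) / (2 * reg.L k + 1)) ^ 4) →
      ∀ ε : ℝ, 0 < ε → ∀ᶠ k : ℕ in atTop, ∀ S : ℕ, reg.L k ≤ S →
        ∀ (f : Fin Nf) (x₀ : TorusSite 4 (2 * S + 1)) (r : ℕ) (τ : ℝ), 0 < τ → τ ≤ (c * (reg.a k * m f / reg.Zm k)) →
          qcdPhaseQuenchedExpect (reg.β k) (2 * S + 1) (fun fl => reg.mcrit k + reg.a k * m fl / reg.Zm k)
              (fun U : GaugeConfig 4 (2 * S + 1) SU3 => if (∃ φ : Idx (2 * S + 1) 3 → ℂ, φ ≠ 0 ∧ (∀ p, r < torusTaxiDist p.1 x₀ → φ p = 0) ∧ ∑ p, ‖(hermitianWilsonDirac (fundamentalRep (Fin 3)) U (reg.mcrit k + reg.a k * m f / reg.Zm k) 1 *ᵥ φ) p‖ ^ 2 < τ ^ 2 * ∑ p, ‖φ p‖ ^ 2) then (1 : ℝ) else 0) ≤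
            ε * ((4 * (r : ℝ) + 5) ^ 4 / (2 * reg.L k + 1) ^ 4) := by
  intro Nf reg c m hc hm hEXT ε hε
  filter_upwards [hEXT ε hε] with k hk
  intro S hS f x₀ r τ hτ hτw
  -- data at step `k` on the torus of side `2S+1`
  set mq : Fin Nf → ℝ := fun fl => reg.mcrit k + reg.a k * m fl / reg.Zm k
  set m₀ : ℝ := reg.mcrit k + reg.a k * m f / reg.Zm k
  set N : GaugeConfig 4 (2 * S + 1) SU3 → ℝ := fun U => ∑ f : Fin Nf, ((Multiset.countP (fun z : ℂ => z.im = 0 ∧ z.re < -(reg.mcrit k + reg.a k * m f / reg.Zm k)) (wilsonDirac (fundamentalRep (Fin 3)) U 0 1).charpoly.roots : ℝ) + (Multiset.countP (fun z : ℂ => |z.re| < c * (reg.a k * m f / reg.Zm k)) (spinorLift gammaFive * wilsonDirac (fundamentalRep (Fin 3)) U (reg.mcrit k + reg.a k * m f / reg.Zm k) 1).charpoly.roots : ℝ)) with hN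
  have hkS : qcdPhaseQuenchedExpect (reg.β k) (2 * S + 1) mq N ≤ ε * ((2 * S + 1 : ℝ) / (2 * reg.L k + 1)) ^ 4 := hk S hS
  -- the bad-ball indicators, one per centre
  set ind : TorusSite 4 (2 * S + 1) → GaugeConfig 4 (2 * S + 1) SU3 → ℝ := fun x U =>
    if (∃ φ : Idx (2 * S + 1) 3 → ℂ, φ ≠ 0 ∧ (∀ p, r < torusTaxiDist p.1 x → φ p = 0) ∧
      ∑ p, ‖(hermitianWilsonDirac (fundamentalRep (Fin 3)) U m₀ 1 *ᵥ φ) p‖ ^ 2 < τ ^ 2 * ∑ p, ‖φ p‖ ^ 2)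
    then (1 : ℝ) else 0 with hind
  change qcdPhaseQuenchedExpect (reg.β k) (2 * S + 1) mq (ind x₀) ≤ _
  -- `⟨·⟩₊` is the integral against the probability measure `P`
  set P : Measure (GaugeConfig 4 (2 * S + 1) SU3) := qcdLatticeMeasure (2 * S + 1) (reg.β k) mq
  haveI : IsProbabilityMeasure P := isProbabilityMeasure_qcdLatticeMeasure_all (reg.β k) mq
  have hE : ∀ ψ : GaugeConfig 4 (2 * S + 1) SU3 → ℝ,
      qcdPhaseQuenchedExpect (reg.β k) (2 * S + 1) mq ψ = ∫ U, ψ U ∂P := fun ψ =>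
    qcdPhaseQuenchedExpect_eq_integral_qcdLatticeMeasure (reg.β k) mq ψ
  -- (i) the indicators take values in `{0,1}`, are measurable (the bad event is open) and are translates of each other
  have hind01 : ∀ x U, 0 ≤ ind x U ∧ ind x U ≤ 1 := fun x U => by simp only [hind]; split_ifs <;> norm_num
  have hImeas : ∀ x, Measurable (ind x) := fun x =>
    Measurable.ite (locRar_measurableSet_bad m₀ τ x r) measurable_const measurable_const
  have hIint : ∀ x, Integrable (ind x) P := fun x =>
    (integrable_const (1 : ℝ)).mono' (hImeas x).aestronglyMeasurable
      (ae_of_all _ fun U => by rw [Real.norm_eq_abs, abs_of_nonneg (hind01 x U).1]; exact (hind01 x U).2)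
  have htrans : ∀ x, qcdPhaseQuenchedExpect (reg.β k) (2 * S + 1) mq (ind x) =
      qcdPhaseQuenchedExpect (reg.β k) (2 * S + 1) mq (ind x₀) := by
    intro x
    have hfun : ind x = fun U => ind x₀ (torusConfigShift (x₀ - x) U) := by
      funext U
      simp only [hind, locRar_bad_iff_bad_torusConfigShift U m₀ τ x₀ x r]
    rw [hfun]
    exact locRar_qcdPhaseQuenchedExpect_comp_torusConfigShift (reg.β k) mq (x₀ - x) (ind x₀)
  -- (ii) the EXTINCT integrand is measurable and bounded, hence integrable
  have hNmeas : Measurable N := by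
    have hc : ∀ g : GaugeConfig 4 (2 * S + 1) SU3 → ℕ, Measurable g → Measurable fun U => (g U : ℝ) :=
      fun g hg => measurable_from_nat.comp hg
    rw [hN]
    refine Finset.measurable_sum _ fun f' _ => ?_
    exact (hc _ (measurable_signDefectCount _)).add (hc _ (measurable_coercivityDefectCount _ _))
  have hNint : Integrable N P := by
    refine Integrable.of_bound hNmeas.aestronglyMeasurable
      (∑ _f : Fin Nf, ((Fintype.card (QuarkIdx (2 * S + 1)) : ℝ) + Fintype.card (QuarkIdx (2 * S + 1))))
      (ae_of_all _ fun U => ?_)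
    rw [hN, Real.norm_eq_abs, abs_of_nonneg (Finset.sum_nonneg fun f' _ => by positivity)]
    refine Finset.sum_le_sum fun f' _ => add_le_add ?_ ?_
    · exact_mod_cast countP_roots_charpoly_le_card _ _
    · exact_mod_cast countP_roots_charpoly_le_card _ _
  -- (iii) pointwise counting: `Σ_x 1_bad(x) = #{bad centres} ≤ (4r+5)⁴ #{|λ| < τ} ≤ (4r+5)⁴ N`
  have hpt : ∀ U, ∑ x, ind x U ≤ (4 * (r : ℝ) + 5) ^ 4 * N U := by
    intro U
    have h1 : ∑ x, ind x U = ((Finset.univ.filter fun x : TorusSite 4 (2 * S + 1) => ∃ φ : Idx (2 * S + 1) 3 → ℂ,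
        φ ≠ 0 ∧ (∀ p, r < torusTaxiDist p.1 x → φ p = 0) ∧
        ∑ p, ‖(hermitianWilsonDirac (fundamentalRep (Fin 3)) U m₀ 1 *ᵥ φ) p‖ ^ 2 < τ ^ 2 * ∑ p, ‖φ p‖ ^ 2).card : ℝ) := by
      simp only [hind]
      exact Finset.sum_boole (R := ℝ) _ _
    have h2 := locRar_card_bad_le U m₀ τ hτ r
    have h3 : (hermitianWilsonDirac (fundamentalRep (Fin 3)) U m₀ 1).charpoly.roots.countP (fun z : ℂ => |z.re| < τ) ≤
        (spinorLift gammaFive * wilsonDirac (fundamentalRep (Fin 3)) U m₀ 1).charpoly.roots.countP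
          (fun z : ℂ => |z.re| < c * (reg.a k * m f / reg.Zm k)) :=
      countP_le_countP_of_imp _ fun z hz => hz.trans_le hτw
    have h4 : ((spinorLift gammaFive * wilsonDirac (fundamentalRep (Fin 3)) U m₀ 1).charpoly.roots.countP
        (fun z : ℂ => |z.re| < c * (reg.a k * m f / reg.Zm k)) : ℝ) ≤ N U := by
      simp only [hN]
      exact (le_add_of_nonneg_left (Nat.cast_nonneg _)).trans (Finset.single_le_sum (f := fun f' : Fin Nf =>
        (Multiset.countP (fun z : ℂ => z.im = 0 ∧ z.re < -(reg.mcrit k + reg.a k * m f' / reg.Zm k))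
          (wilsonDirac (fundamentalRep (Fin 3)) U 0 1).charpoly.roots : ℝ) +
        (Multiset.countP (fun z : ℂ => |z.re| < c * (reg.a k * m f' / reg.Zm k)) (spinorLift gammaFive *
          wilsonDirac (fundamentalRep (Fin 3)) U (reg.mcrit k + reg.a k * m f' / reg.Zm k) 1).charpoly.roots : ℝ))
        (fun _ _ => by positivity) (Finset.mem_univ f))
    rw [h1]
    calc _ ≤ (((4 * r + 5) ^ 4 * (hermitianWilsonDirac (fundamentalRep (Fin 3)) U m₀ 1).charpoly.roots.countP
          (fun z : ℂ => |z.re| < τ) : ℕ) : ℝ) := by exact_mod_cast h2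
      _ ≤ (4 * (r : ℝ) + 5) ^ 4 * N U := by
          push_cast
          exact mul_le_mul_of_nonneg_left ((by exact_mod_cast h3 : (_ : ℝ) ≤ _).trans h4) (by positivity)
  -- (iv) averaging: `(2S+1)⁴ ⟨1_bad(x₀)⟩₊ = Σ_x ⟨1_bad(x)⟩₊ = ⟨#{bad centres}⟩₊ ≤ (4r+5)⁴ ⟨N⟩₊`
  have hcardT : (Fintype.card (TorusSite 4 (2 * S + 1)) : ℝ) = (2 * S + 1 : ℝ) ^ 4 := by
    rw [show Fintype.card (TorusSite 4 (2 * S + 1)) = (2 * S + 1) ^ 4 by simp [ZMod.card]]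
    push_cast; ring
  have key : (2 * S + 1 : ℝ) ^ 4 * qcdPhaseQuenchedExpect (reg.β k) (2 * S + 1) mq (ind x₀) ≤
      (4 * (r : ℝ) + 5) ^ 4 * (ε * ((2 * S + 1 : ℝ) / (2 * reg.L k + 1)) ^ 4) := by
    calc (2 * S + 1 : ℝ) ^ 4 * qcdPhaseQuenchedExpect (reg.β k) (2 * S + 1) mq (ind x₀)
        = ∑ x : TorusSite 4 (2 * S + 1), qcdPhaseQuenchedExpect (reg.β k) (2 * S + 1) mq (ind x) := by
          rw [Finset.sum_congr rfl fun x _ => htrans x, Finset.sum_const, Finset.card_univ, nsmul_eq_mul, hcardT]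
      _ = qcdPhaseQuenchedExpect (reg.β k) (2 * S + 1) mq (fun U => ∑ x, ind x U) := by
          simp_rw [hE]
          rw [integral_finsetSum _ fun x _ => hIint x]
      _ ≤ qcdPhaseQuenchedExpect (reg.β k) (2 * S + 1) mq (fun U => (4 * (r : ℝ) + 5) ^ 4 * N U) := by
          rw [hE, hE]
          exact integral_mono (integrable_finsetSum _ fun x _ => hIint x) (hNint.const_mul _) hpt
      _ = (4 * (r : ℝ) + 5) ^ 4 * qcdPhaseQuenchedExpect (reg.β k) (2 * S + 1) mq N := by
          rw [hE, hE, integral_const_mul]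
      _ ≤ (4 * (r : ℝ) + 5) ^ 4 * (ε * ((2 * S + 1 : ℝ) / (2 * reg.L k + 1)) ^ 4) :=
          mul_le_mul_of_nonneg_left hkS (by positivity)
  have hS0 : (0 : ℝ) < (2 * S + 1 : ℝ) ^ 4 := by positivity
  have hL0 : (0 : ℝ) < 2 * (reg.L k : ℝ) + 1 := by positivity
  calc qcdPhaseQuenchedExpect (reg.β k) (2 * S + 1) mq (ind x₀)
      = ((2 * S + 1 : ℝ) ^ 4 * qcdPhaseQuenchedExpect (reg.β k) (2 * S + 1) mq (ind x₀)) / (2 * S + 1 : ℝ) ^ 4 :=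
        (eq_div_iff hS0.ne').2 (mul_comm _ _)
    _ ≤ (4 * (r : ℝ) + 5) ^ 4 * (ε * ((2 * S + 1 : ℝ) / (2 * reg.L k + 1)) ^ 4) / (2 * S + 1 : ℝ) ^ 4 :=
        div_le_div_of_nonneg_right key hS0.le
    _ = ε * ((4 * (r : ℝ) + 5) ^ 4 / (2 * reg.L k + 1) ^ 4) := by
        field_simp

end Summit.QuantumFields.QCD.Cruxes.ExtinctionBuildsQCD.DeterminantTilt

end
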